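import Summits.QuantumAdvantage.QuantumAdvantage.Theorems.WhiteBoxWalkDefs
import Literature.Computability.Complexity.UnaryBricks
import Literature.Computability.Complexity.PlumbingBricks
import Literature.Computability.Complexity.StackBricksArith
import Literature.Computability.Complexity.StackBricksStrings
import Literature.Computability.Complexity.QuadraticCongruencesFactMachine

/-!
# Route `WhiteBoxWalk`, crux `WbwThesis` (stmt-QuantumAdvantage-2238), line `Sketch`: `fPQ ∈ FP`

`stub_fPQ_polyTime`: the prime-pair product function `fPQ` (Goldreich's `f_mult` with an
AKS-certified, tagged hard branch) is computable in polynomial time, `PolyTimeComputable id id fPQ`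
(literally `fPQ ∈ FP`).

The proof writes `fPQ` as ONE composite of the tree's polynomial-time string bricks, proves the
composite is in `FP` by the closure lemmas (`comp_mem_FP`, `fanoutFn_mem_FP`, `iteFn_mem_FP`,
`andFn_mem_FP`), and proves it agrees with `fPQ` on every input.  No new definitions: the pieces are
`set` abbreviations inside the proof; the three brick identities it needs are the lemmas of the
sub-namespace `FPQ`.  On a block `x` with `m = ⌊|x|/2⌋`:

* `halfFn x = 1ᵐ` (`UnaryBricks`), so `U x = takeFn ⟨1ᵐ, x⟩ = x ↾ m` and
  `V x = takeFn ⟨1ᵐ, dropFn ⟨1ᵐ, x⟩⟩ = (x ⇂ m) ↾ m` are the two halves (`PlumbingBricks`), with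
  values `pOf x`, `qOf x`;
* primality bits: `primeFn (norm u) = [decide (Prime ⟦u⟧)]` (`FPQ.primeFn_norm`; `norm u = encodeNat ⟦u⟧`
  is the canonical numeral, `primeFn ∈ FP` is AKS, `PRIMES ∈ P`);
* top-bit tests: `2^k ≤ p ↔ p mod 2^k < p` and `p mod 2^k = ⟦u ↾ k⟧`, so the bit `2^{m-1} ≤ ⟦u⟧` is
  `ltFn ⟨takeFn ⟨1^{m-1}, u⟩, u⟩` (`FPQ.ltFn_take_eq`) with `1^{m-1} = dropFn ⟨[1], 1ᵐ⟩` (for `m = 0`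
  both sides read `1 ≤ p`, false on the empty half, as in `isPrimePair`);
* the conjunction of the four bits is `andFn`-ed to `[isPrimePair x]`;
* the product numeral `prodFn ⟨u, v⟩ = encodeNat (pOf x · qOf x)` (`StackBricksArith`), cut or
  zero-padded to width `|x|` by `fstF (padTakeFn ⟨x, ·⟩) = takeD |x| · false = encW |x| ·`
  (`FPQ.fstF_padTakeFn_encodeNat`, `StackBricksStrings`);
* the tag and the branch: `iteFn [isPrimePair x] (1 :: encW |x| (P·Q)) (0 :: x)` (`BranchingFn`).

References: O. Goldreich, *Foundations of Cryptography I* (2001), §2.2.4.1 (`f_mult`);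
M. Agrawal, N. Kayal, N. Saxena, *PRIMES is in P*, Ann. Math. 160 (2004);
S. Arora, B. Barak, *Computational Complexity* (2009), §1.3 (closure of polynomial time).
-/

noncomputable section

set_option linter.dupNamespace false -- D-0017: single-problem summit ⇒ `QuantumAdvantage.QuantumAdvantage` by design

namespace Summit.QuantumAdvantage.QuantumAdvantage.Theorems.WhiteBoxWalk

open Literature.Computability.Cryptography Literature.Computability.Complexity
open _root_.Computability
open Literature.Computability.Complexity.Brick (halfFn halfFn_mem_FP length_halfFn fstF fstF_boolPair
  fstF_mem_FP andFn andFn_apply andFn_mem_FP norm_mem_FP ltFn ltFn_boolPair ltFn_mem_FP prodFn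
  prodFn_boolPair prodFn_mem_FP padTakeFn padTakeFn_boolPair padTakeFn_mem_FP)
open Literature.Computability.Complexity.Plumb (takeFn takeFn_boolPair takeFn_mem_FP dropFn
  dropFn_boolPair dropFn_mem_FP)
open Literature.Computability.Complexity.QuadCongNP (primeFn primeFn_mem_FP)
open Literature.Computability.Complexity.QuadCongFP (primeFn_encodeNat)

namespace FPQ

/-! ### Three brick identities -/

/-- **The top-bit test by a truncation**: `ltFn ⟨u ↾ k, u⟩ = [decide (2^k ≤ ⟦u⟧)]`, because
`⟦u ↾ k⟧ = ⟦u⟧ mod 2^k` and `2^k ≤ p ↔ p mod 2^k < p`. -/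
theorem ltFn_take_eq (k : ℕ) (u : List Bool) :
    ltFn (boolPair (u.take k) u) = [decide (2 ^ k ≤ bitsToNat u)] := by
  rw [ltFn_boolPair, Brick.bitsToNat_take]
  have key : bitsToNat u % 2 ^ k < bitsToNat u ↔ 2 ^ k ≤ bitsToNat u := by
    refine ⟨fun h => ?_, fun h => (Nat.mod_lt _ (Nat.two_pow_pos k)).trans_le h⟩
    by_contra h'
    rw [Nat.mod_eq_of_lt (Nat.lt_of_not_le h')] at h
    exact lt_irrefl _ h
  simpa using key

/-- **The primality bit of a raw numeral**: `primeFn (norm u) = [decide (Prime ⟦u⟧)]` (`norm u` is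
the canonical numeral `encodeNat ⟦u⟧`, on which `primeFn` — AKS — reads primality). -/
theorem primeFn_norm (u : List Bool) : primeFn (norm u) = [decide (bitsToNat u).Prime] := by
  rw [norm_eq_encodeNat, primeFn_encodeNat]

/-- **Fixed width by `padTakeFn`**: `fstF (padTakeFn ⟨x, encodeNat v⟩) = encW |x| v` (the numeral
cut or zero-padded to width `|x|`: `takeD n c 0 = (c ↾ n) ++ 0^{n - |c|}`). -/
theorem fstF_padTakeFn_encodeNat (x : List Bool) (v : ℕ) :
    fstF (padTakeFn (boolPair x (encodeNat v))) = encW x.length v := by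
  have key : ∀ (n : ℕ) (l : List Bool), l.takeD n false = l.take n ++ List.replicate (n - l.length) false := by
    intro n
    induction n with
    | zero => intro l; simp
    | succ n ih => intro l; cases l <;> simp [ih, List.replicate_succ]
  rw [padTakeFn_boolPair, fstF_boolPair, key]
  rfl

end FPQ

/-- **`fPQ ∈ FP`** (line `Sketch`, stub `stub_fPQ_polyTime`): `fPQ` is a polynomial-time brick
composite — halves `U`, `V` by `takeFn`/`dropFn` after `halfFn`, primality by AKS (`primeFn_mem_FP`)
on the canonical numerals (`norm`), the top-bit tests by `ltFn` on a truncation to `m - 1` symbols,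
their conjunction by `andFn`, the product by `prodFn`, the fixed width by `padTakeFn`, the tag and the
branch by `iteFn` and cons bricks; the composite agrees with `fPQ` pointwise.
[Goldreich 2001, §2.2.4.1; Agrawal–Kayal–Saxena 2004; Arora–Barak 2009, §1.3] -/
theorem stub_fPQ_polyTime : PolyTimeComputable id id fPQ := by
  -- the pieces (no definitions: local abbreviations)
  set U : List Bool → List Bool := takeFn ∘ fanoutFn halfFn id with hU
  set V : List Bool → List Bool := takeFn ∘ fanoutFn halfFn (dropFn ∘ fanoutFn halfFn id) with hV
  set M1 : List Bool → List Bool := dropFn ∘ fanoutFn (fun _ => [true]) halfFn with hM1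
  set TU : List Bool → List Bool := ltFn ∘ fanoutFn (takeFn ∘ fanoutFn M1 U) U with hTU
  set TV : List Bool → List Bool := ltFn ∘ fanoutFn (takeFn ∘ fanoutFn M1 V) V with hTV
  set C : List Bool → List Bool :=
    andFn (primeFn ∘ norm ∘ U) (andFn (primeFn ∘ norm ∘ V) (andFn TU TV)) with hC
  set W : List Bool → List Bool := fstF ∘ padTakeFn ∘ fanoutFn id (prodFn ∘ fanoutFn U V) with hW
  set F : List Bool → List Bool := iteFn C (List.cons true ∘ W) (List.cons false) with hF
  -- membership in FP, by the closure lemmas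
  have mU : U ∈ FP := comp_mem_FP takeFn_mem_FP (fanoutFn_mem_FP halfFn_mem_FP OracleCompose.id_mem_FP)
  have mV : V ∈ FP :=
    comp_mem_FP takeFn_mem_FP (fanoutFn_mem_FP halfFn_mem_FP
      (comp_mem_FP dropFn_mem_FP (fanoutFn_mem_FP halfFn_mem_FP OracleCompose.id_mem_FP)))
  have mM1 : M1 ∈ FP := comp_mem_FP dropFn_mem_FP (fanoutFn_mem_FP (const_mem_FP _) halfFn_mem_FP)
  have mT : ∀ {g : List Bool → List Bool}, g ∈ FP → ltFn ∘ fanoutFn (takeFn ∘ fanoutFn M1 g) g ∈ FP :=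
    fun hg => comp_mem_FP ltFn_mem_FP
      (fanoutFn_mem_FP (comp_mem_FP takeFn_mem_FP (fanoutFn_mem_FP mM1 hg)) hg)
  have mP : ∀ {g : List Bool → List Bool}, g ∈ FP → primeFn ∘ norm ∘ g ∈ FP :=
    fun hg => comp_mem_FP primeFn_mem_FP (comp_mem_FP norm_mem_FP hg)
  have mC : C ∈ FP := andFn_mem_FP (mP mU) (andFn_mem_FP (mP mV) (andFn_mem_FP (mT mU) (mT mV)))
  have mW : W ∈ FP :=
    comp_mem_FP fstF_mem_FP (comp_mem_FP padTakeFn_mem_FP (fanoutFn_mem_FP OracleCompose.id_mem_FP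
      (comp_mem_FP prodFn_mem_FP (fanoutFn_mem_FP mU mV))))
  have mF : F ∈ FP := iteFn_mem_FP mC (comp_mem_FP (cons_mem_FP true) mW) (cons_mem_FP false)
  -- values
  have eU : ∀ x, U x = x.take (x.length / 2) := fun x => by simp [hU]
  have eV : ∀ x, V x = (x.drop (x.length / 2)).take (x.length / 2) := fun x => by simp [hV]
  have eM1 : ∀ x, (M1 x).length = x.length / 2 - 1 := fun x => by simp [hM1]
  have eT : ∀ (g : List Bool → List Bool) (x : List Bool),
      (ltFn ∘ fanoutFn (takeFn ∘ fanoutFn M1 g) g) x = [decide (2 ^ (x.length / 2 - 1) ≤ bitsToNat (g x))] :=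
    fun g x => by
      simp only [Function.comp_apply, fanoutFn_apply, takeFn_boolPair, eM1, FPQ.ltFn_take_eq]
  have eP : ∀ (g : List Bool → List Bool) (x : List Bool),
      (primeFn ∘ norm ∘ g) x = [decide (bitsToNat (g x)).Prime] :=
    fun g x => by simp only [Function.comp_apply, FPQ.primeFn_norm]
  have eC : ∀ x, C x = [isPrimePair x] := fun x => by
    rw [hC, andFn_apply (eP U x) (andFn_apply (eP V x) (andFn_apply (eT U x) (eT V x)))]
    simp only [eU, eV, isPrimePair, pOf, qOf, Bool.decide_and]
  have eW : ∀ x, W x = encW x.length (pOf x * qOf x) := fun x => by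
    simp only [hW, Function.comp_apply, fanoutFn_apply, prodFn_boolPair, eU, eV, id_eq,
      FPQ.fstF_padTakeFn_encodeNat]
    rfl
  have eF : fPQ = F := funext fun x => by
    rw [hF, iteFn_apply (eC x), fPQ]
    simp only [Function.comp_apply, eW]
  -- conclusion: `fPQ = F ∈ FP`, and `FP = {f | PolyTimeComputable id id f}`
  rw [eF]
  exact mF

end Summit.QuantumAdvantage.QuantumAdvantage.Theorems.WhiteBoxWalk

end
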